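import Summits.BirchSwinnertonDyer.BirchSwinnertonDyer.Theses.UniversalToricDescent
import Summits.BirchSwinnertonDyer.BirchSwinnertonDyer.Theorems.UniversalToricDescentToricTransportModThreeReduction
import Summits.BirchSwinnertonDyer.BirchSwinnertonDyer.Theorems.UniversalToricDescentBDPFlatMuTransfer
import Summits.BirchSwinnertonDyer.BirchSwinnertonDyer.Theorems.SchneiderFreeAdditiveX3GordTwoBranchIMCDivOfKY
import Summits.BirchSwinnertonDyer.BirchSwinnertonDyer.Theorems.SignedBaseChangeTwistPairGreenbergProductDivisibilitySplitBigImage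
import Summits.BirchSwinnertonDyer.Rank1Residual.X11b.BDPRouteHsiehFrame
import Summits.BirchSwinnertonDyer.Rank1Residual.X11b.LambdaSupplyPrime
import Summits.BirchSwinnertonDyer.Rank1Residual.X11b.FrameIdealRigidity
import Literature.NumberTheory.EllipticCurves.Hsieh2014.AnticyclotomicMuInvariant
import HarnessLib

/-!
# Route `UniversalToricDescent`, crux #2 `ToricTransportModThree` (stmt-BirchSwinnertonDyer-20186), line
# `gvtransport`: STUB A `stub_twinMuZero` = child `TwinMuZeroAtThree` (stmt-…-20400) — the twin's `μ = 0`
# — from PRINT (Hsieh 2014 Thm. B by name) + tree glue + the ♭ `μ`-transfer theorem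

Lead prover bsd-wall-utd-p1 g3 (cell `pub/bsd-wall`, W-ALL lane 3). The registered stub (skeleton of record
sha16 `4f0c52dad1e641b3`, `Cruxes.ToricTransportModThree.GvTransport.stub_twinMuZero`) says: for the
semistable-at-`3` twin `E′` of the wild curve `E` (`E′[3] ≅ E[3]`, `ρ̄_{E,3}` onto, `K` classical Heegner
for `N(E′)`, `3 = 𝔭𝔭′` split, `κ` anticyclotomic with generator `γ`, `ι′` inducing `𝔭`), EVERY `R₀`-frame
`(Ω_K ≠ 0, Ω_p ≠ 0, L′)` with `IsBDPLFunction ι′ 𝔭 κ γ f_{E′} Ω_K Ω_p L′` has a coefficient of norm `1`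
(`μ(L′) = 0`). What this file proves, sorry-free:

* §1 (every `p`, glue) `exists_isBDPLFunctionInt_of_isHsiehLFunction_of_not_dvd` — the `p ∤ N` twin
  of the tree's `X11b.exists_isBDPLFunctionInt_of_isHsiehLFunction` (`p ∣ N`): a Hsieh witness
  `(A, Ω_K, C, Ω_p, Q)` yields Castella's ♭-frame `((16A²)^{1/4}Ω_K, Ω_p, (ι'⁻¹C)⁻¹·Q)`; both glues
  preserve "some coefficient has norm `1`" (`exists_coeff_norm_eq_one_C_mul`).
* §2 **`twin_exists_isBDPLFunctionInt_coeff_norm_eq_one`** — FROM PRINT: granted Hsieh 2014 Thm. B by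
  NAME (`Hsieh2014.thmB_exists_isHsiehLFunction_coeff_norm_eq_one`, refereed, `p ≠ 2`, `v_p(N) ≤ 1` —
  so it covers ALL three twin buckets of TWIN-PRINT-AT3-v1 §2: good ordinary, multiplicative, good
  supersingular), the twin has a ♭-frame `(Ω_K ≠ 0, ‖Ω_p‖ = 1, Q ∈ 𝓞_{ℂ_3}⟦T⟧)` with Castella's
  interpolation property `R1.IsBDPLFunctionInt 3 ι′ 𝔭 κ γ f_{E′} Ω_K Ω_p Q` AND `∃ i, ‖[T^i]Q‖ = 1`.
  Hsieh's binders are discharged from the twin's: `ρ̄_{E′,3}` onto (transported along `E′[3] ≅ E[3]`,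
  `UniversalToricDescentReduction.hasSurjectiveModNGaloisRep_of_modPCongruent`) ⇒ every framing of
  `E′[3]|_{Γ_K}` absolutely irreducible (`SignedBaseChangeK1BigImage.irrM_framed_of_surj`, `[K:ℚ] = 2 < 3`);
  `¬ Addv E′ 3 ⇒ 9 ∤ N(E′)`; `3` split from `e(𝔭) = f(𝔭) = 1`; `BranchInducesPrime 3 ι′ 𝔭` IS Hsieh's
  compatibility clause; the auxiliary `λ` from `X11b.lambdaSupplyAt` (every odd prime).
* §3 **`stub_twinMuZero_of_thmB`** — the REGISTERED signature of `stub_twinMuZero` (= child item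
  `TwinMuZeroAtThree`, stmt-BirchSwinnertonDyer-20400, **`twinMuZeroAtThree_of_thmB`** by name) follows from §2
  ALONE: the cross-period, cross-receptacle `μ`-transfer is the THEOREM
  `UniversalToricDescentFlatMuTransfer.exists_coeff_norm_eq_one_of_isBDPLFunctionInt_of_isBDPLFunction`
  (file `…Theorems/UniversalToricDescentBDPFlatMuTransfer.lean`: cn100's power-map functional equation in ♭
  currency + reduction modulo `𝔪_{ℂ_3}`; no Weierstrass preparation over `𝓞_{ℂ_3}`, no `R₀`-descent of
  Hsieh's object), which supersedes utd-p2's finding F2 for this child. (At odd `p` the same transfer also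
  follows from x11b3/multr1's ♭ ideal rigidity `X11b.R1.exists_unit_mul_eq_of_isBDPLFunctionInt`
  (`X11b/FrameIdealRigidity.lean`) with `R1.isBDPLFunctionInt_map` and the algebra
  `exists_coeff_norm_eq_one_of_isUnit_mul` below — a unit multiple keeps a norm-one coefficient —, kept as API.)

HONEST STATUS: child 20400 / stub A is CLOSED MODULO ONE PUBLISHED FACT BY NAME (`hB` = Hsieh 2014
Thm. B, refereed); nothing else of crux 20186 is touched (children 20395 = the wall, 20399 = invariants
transport stay open). No definition, no `sorry`, standard axioms.

References: [Hsieh2014] M.-L. Hsieh, Doc. Math. 19 (2014) 709–767, Thm. B (p. 713), Thm. A (p. 712);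
[Castella2018] F. Castella, Camb. J. Math. 6 (2018), Thm. 3.1 (arXiv:1704.06608 p. 9);
[CastellaHsieh2018] Math. Ann. 370 (2018), §3.3, Def. 3.5, Prop. 3.6.
-/

set_option linter.dupNamespace false

noncomputable section

open scoped Classical NumberField
open NumberField IsDedekindDomain Field PowerSeries
open Literature.NumberTheory.GaloisRepresentations
open Literature.NumberTheory.EllipticCurves
open Literature.NumberTheory.EllipticCurves.ModularForms
open Literature.NumberTheory.EllipticCurves.Rank1Residual
open Summit.BirchSwinnertonDyer.Rank1Residual
open Summit.BirchSwinnertonDyer.Rank1Residual.X11b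

namespace Summit.BirchSwinnertonDyer.BirchSwinnertonDyer.Theorems.UniversalToricDescentTwinMuZero

/-! ### §1 Glue at every `p`: Hsieh's display ⟹ Castella's ♭-display, and norm-one coefficients -/

section Glue

variable {p : ℕ} [Fact p.Prime] {K : Type} [Field K] [NumberField K] {N : ℕ}

omit [Fact p.Prime] in
/-- **Hsieh's display IS Castella's display at the rescaled period, case `p ∤ N`**: with `c^4 = 16A²`,
`hsiehInterpolationValue p f 𝔭 χ n A Ω_K' 1 = bdpInterpolationValue p f 𝔭 χ n (c·Ω_K')` (at `p ∤ N` Hsieh's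
monomial is `(16A²)^{-n}`, no Steinberg `p^n`; companion of the tree's `p ∣ N` lemma
`X11b.Three.hsiehInterpolationValue_eq_bdpInterpolationValue_rescale`).
[cite: Hsieh2014, Thm. A p. 712 (Doc. Math. 19) = Thm. 1 (arXiv:1112.1580 p. 4)]
[cite: Castella2018, Thm. 3.1 (arXiv:1704.06608 p. 9)] -/
theorem hsiehInterpolationValue_eq_bdpInterpolationValue_rescale_of_not_dvd (hpN : ¬ p ∣ N)
    (f : CuspForm (CongruenceSubgroup.Gamma0 N) 2) (𝔭 : HeightOneSpectrum (𝓞 K))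
    (χ : HeckeCharacter K) (n : ℕ) {A : ℝ} (hA : A ≠ 0) (ΩK' c : ℂ) (hc : c ≠ 0)
    (hc4 : c ^ 4 = 16 * (A : ℂ) ^ 2) :
    hsiehInterpolationValue p f 𝔭 χ n A ΩK' 1 = bdpInterpolationValue p f 𝔭 χ n (c * ΩK') := by
  rw [Three.bdpInterpolationValue_periodRescale p f 𝔭 χ n ΩK' c hc,
    hsiehInterpolationValue_eq_mul_bdpInterpolationValue, if_neg hpN, hc4, one_mul]
  congr 1
  have hA' : (A : ℂ) ≠ 0 := Complex.ofReal_ne_zero.mpr hA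
  have h16 : (4 : ℂ) ^ (2 * n) = (16 : ℂ) ^ n := by
    rw [pow_mul]; norm_num
  rw [h16, mul_pow, ← pow_mul]
  field_simp

/-- **Hsieh witness ⟹ Castella ♭-frame, case `p ∤ N`** (companion of the tree's
`X11b.exists_isBDPLFunctionInt_of_isHsiehLFunction`, which is the case `p ∣ N`): a Hsieh witness
`(A, Ω_K, C, Ω_p, Q)` — `IsHsiehLFunction ι' 𝔭 κ γ f A Ω_K C Ω_p Q`, `0 < A`, `Ω_K ≠ 0`, `‖ι'⁻¹C‖ = 1` —
yields the ♭-frame `((16A²)^{1/4}·Ω_K, Ω_p, c·Q)`, `c = (ι'⁻¹C)⁻¹ ∈ 𝓞_{ℂ_p}^×`, with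
`R1.IsBDPLFunctionInt p ι' 𝔭 κ γ f Ω_K₁ Ω_p (C(c)·Q)`.
[cite: Hsieh2014, Thm. A p. 712 (Doc. Math. 19) = Thm. 1 (arXiv:1112.1580 p. 4)]
[cite: Castella2018, Thm. 3.1 (arXiv:1704.06608 p. 9)] -/
theorem exists_isBDPLFunctionInt_of_isHsiehLFunction_of_not_dvd (ι' : PadicAlgCl p ≃+* ℂ)
    (𝔭 : HeightOneSpectrum (𝓞 K)) (κ : ZpExtension K p) (γ : Field.absoluteGaloisGroup K)
    (f : CuspForm (CongruenceSubgroup.Gamma0 N) 2) (hpN : ¬ p ∣ N) {A : ℝ} (hA : 0 < A) {ΩK C : ℂ}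
    (hΩK : ΩK ≠ 0) (hC : ‖((ι'.symm C : PadicAlgCl p) : ℂ_[p])‖ = 1) (Ωp : ℂ_[p])
    {Q : PowerSeries 𝓞_ℂ_[p]} (hQ : IsHsiehLFunction ι' 𝔭 κ γ f A ΩK C Ωp Q) :
    ∃ (ΩK₁ : ℂ) (c : 𝓞_ℂ_[p]), ΩK₁ ≠ 0 ∧ ‖(c : ℂ_[p])‖ = 1 ∧
      R1.IsBDPLFunctionInt p ι' 𝔭 κ γ f ΩK₁ Ωp (PowerSeries.C c * Q) := by
  obtain ⟨c₄, hc₄, hc₄4⟩ := Three.exists_pos_pow_four_eq (x := 16 * A ^ 2) (by positivity)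
  have hcC : (c₄ : ℂ) ≠ 0 := Complex.ofReal_ne_zero.mpr hc₄.ne'
  have hc4C : (c₄ : ℂ) ^ 4 = 16 * (A : ℂ) ^ 2 := by
    have := congrArg (fun t : ℝ ↦ (t : ℂ)) hc₄4
    push_cast at this ⊢
    exact this
  set d : ℂ_[p] := ((ι'.symm C : PadicAlgCl p) : ℂ_[p]) with hd
  have hd0 : d ≠ 0 := fun h ↦ by rw [h, norm_zero] at hC; exact zero_ne_one hC
  have hdinv : ‖d⁻¹‖ = 1 := by rw [norm_inv, hC, inv_one]
  let c : 𝓞_ℂ_[p] := ⟨d⁻¹, Literature.NumberTheory.LFunctions.Dwork.mem_unitBall.mpr hdinv.le⟩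
  refine ⟨(c₄ : ℂ) * ΩK, c, mul_ne_zero hcC hΩK, hdinv, ?_⟩
  intro χ n hn hunr hinf r hr hκ
  have hv := hQ χ n hn hunr hinf r hr hκ
  rw [Three.hsiehInterpolationValue_const p f 𝔭 χ n A ΩK C,
    hsiehInterpolationValue_eq_bdpInterpolationValue_rescale_of_not_dvd hpN f 𝔭 χ n hA.ne' ΩK (c₄ : ℂ)
      hcC hc4C, map_mul, UniformSpace.Completion.coe_mul] at hv
  have hv' := intSeries_hasValueAt_C_mul c hv
  convert hv' using 1
  have hcd : ((c : 𝓞_ℂ_[p]) : ℂ_[p]) * d = 1 := inv_mul_cancel₀ hd0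
  calc ((ι'.symm (bdpInterpolationValue p f 𝔭 χ n ((c₄ : ℂ) * ΩK)) : PadicAlgCl p) : ℂ_[p]) *
        Ωp ^ (4 * n)
      = (((c : 𝓞_ℂ_[p]) : ℂ_[p]) * d) *
          (((ι'.symm (bdpInterpolationValue p f 𝔭 χ n ((c₄ : ℂ) * ΩK)) : PadicAlgCl p) : ℂ_[p]) *
            Ωp ^ (4 * n)) := by rw [hcd, one_mul]
    _ = ((c : 𝓞_ℂ_[p]) : ℂ_[p]) *
          (d * ((ι'.symm (bdpInterpolationValue p f 𝔭 χ n ((c₄ : ℂ) * ΩK)) : PadicAlgCl p) : ℂ_[p]) *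
            Ωp ^ (4 * n)) := by ring

/-- **Hsieh witness ⟹ Castella ♭-frame at EVERY `p`** (the tree's `p ∣ N` glue and the `p ∤ N` glue
above, by cases): some `Ω_K₁ ≠ 0` and a norm-one constant `c` with
`R1.IsBDPLFunctionInt p ι' 𝔭 κ γ f Ω_K₁ Ω_p (C(c)·Q)`.
[cite: Hsieh2014, Thm. A p. 712 (Doc. Math. 19) = Thm. 1 (arXiv:1112.1580 p. 4)]
[cite: Castella2018, Thm. 3.1 (arXiv:1704.06608 p. 9)] -/
theorem exists_isBDPLFunctionInt_of_isHsiehLFunction_any [NeZero N] (ι' : PadicAlgCl p ≃+* ℂ)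
    (𝔭 : HeightOneSpectrum (𝓞 K)) (κ : ZpExtension K p) (γ : Field.absoluteGaloisGroup K)
    (f : CuspForm (CongruenceSubgroup.Gamma0 N) 2) {A : ℝ} (hA : 0 < A) {ΩK C : ℂ}
    (hΩK : ΩK ≠ 0) (hC : ‖((ι'.symm C : PadicAlgCl p) : ℂ_[p])‖ = 1) (Ωp : ℂ_[p])
    {Q : PowerSeries 𝓞_ℂ_[p]} (hQ : IsHsiehLFunction ι' 𝔭 κ γ f A ΩK C Ωp Q) :
    ∃ (ΩK₁ : ℂ) (c : 𝓞_ℂ_[p]), ΩK₁ ≠ 0 ∧ ‖(c : ℂ_[p])‖ = 1 ∧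
      R1.IsBDPLFunctionInt p ι' 𝔭 κ γ f ΩK₁ Ωp (PowerSeries.C c * Q) := by
  by_cases hpN : p ∣ N
  · exact exists_isBDPLFunctionInt_of_isHsiehLFunction ι' 𝔭 κ γ f hpN hA hΩK hC Ωp hQ
  · exact exists_isBDPLFunctionInt_of_isHsiehLFunction_of_not_dvd ι' 𝔭 κ γ f hpN hA hΩK hC Ωp hQ

/-- A norm-one constant multiple keeps a norm-one coefficient: if `‖c‖ = 1` and `‖[T^i]Q‖ = 1` for some
`i`, then `‖[T^i](C(c)·Q)‖ = ‖c‖·‖[T^i]Q‖ = 1`. [folklore] -/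
theorem exists_coeff_norm_eq_one_C_mul {c : 𝓞_ℂ_[p]} (hc : ‖(c : ℂ_[p])‖ = 1)
    {Q : PowerSeries 𝓞_ℂ_[p]} (hQ : ∃ i : ℕ, ‖((PowerSeries.coeff i Q : 𝓞_ℂ_[p]) : ℂ_[p])‖ = 1) :
    ∃ i : ℕ, ‖((PowerSeries.coeff i (PowerSeries.C c * Q) : 𝓞_ℂ_[p]) : ℂ_[p])‖ = 1 := by
  obtain ⟨i, hi⟩ := hQ
  refine ⟨i, ?_⟩
  rw [PowerSeries.coeff_C_mul, MulMemClass.coe_mul, norm_mul, hc, hi, one_mul]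

/-- **A unit multiple of a series with a norm-one coefficient has a norm-one coefficient** (over
`𝓞_{ℂ_p}⟦T⟧`): if `u` is a unit (so `‖[T⁰]u‖ = 1`) and `i₀` is the LEAST index with `‖[T^{i₀}]Q‖ = 1`, then
`[T^{i₀}](u·Q) = [T⁰]u·[T^{i₀}]Q + Σ_{j<i₀} [T^{i₀-j}]u·[T^j]Q` has norm `1`: the first term has norm `1`, the
others norm `< 1` (ultrametric inequality). Equivalently `μ = 0` is invariant under units. [folklore] -/
theorem exists_coeff_norm_eq_one_of_isUnit_mul {u Q : PowerSeries 𝓞_ℂ_[p]} (hu : IsUnit u)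
    (hQ : ∃ i : ℕ, ‖((PowerSeries.coeff i Q : 𝓞_ℂ_[p]) : ℂ_[p])‖ = 1) :
    ∃ i : ℕ, ‖((PowerSeries.coeff i (u * Q) : 𝓞_ℂ_[p]) : ℂ_[p])‖ = 1 := by
  classical
  -- the least index with a norm-one coefficient
  let i₀ : ℕ := Nat.find hQ
  have hi₀ : ‖((PowerSeries.coeff i₀ Q : 𝓞_ℂ_[p]) : ℂ_[p])‖ = 1 := Nat.find_spec hQ
  have hlt : ∀ j < i₀, ‖((PowerSeries.coeff j Q : 𝓞_ℂ_[p]) : ℂ_[p])‖ < 1 := fun j hj ↦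
    lt_of_le_of_ne (R1.norm_coe_padicComplexInt_le_one p _) (Nat.find_min hQ hj)
  -- the constant coefficient of a unit has norm one
  have hu0 : ‖((PowerSeries.constantCoeff u : 𝓞_ℂ_[p]) : ℂ_[p])‖ = 1 := by
    have hcu : IsUnit (PowerSeries.constantCoeff u) := (PowerSeries.isUnit_iff_constantCoeff).mp hu
    obtain ⟨w, hw⟩ := hcu
    rw [← hw]
    exact R1.norm_coe_units_padicComplexInt p w
  refine ⟨i₀, ?_⟩
  -- split the Cauchy product at `i₀` into the leading term and the rest
  let F : ℕ × ℕ → ℂ_[p] := fun ij ↦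
    ((PowerSeries.coeff ij.1 Q * PowerSeries.coeff ij.2 u : 𝓞_ℂ_[p]) : ℂ_[p])
  have hcoe : ((PowerSeries.coeff i₀ (u * Q) : 𝓞_ℂ_[p]) : ℂ_[p]) =
      ∑ ij ∈ Finset.HasAntidiagonal.antidiagonal i₀, F ij := by
    rw [mul_comm u Q, PowerSeries.coeff_mul]
    exact map_sum (PadicComplexInt p).toSubring.subtype _ _
  have hmem : ((i₀, 0) : ℕ × ℕ) ∈ Finset.HasAntidiagonal.antidiagonal i₀ := by simp
  rw [hcoe, ← Finset.add_sum_erase _ _ hmem]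
  -- the leading term has norm one
  have hlead : ‖F (i₀, 0)‖ = 1 := by
    simp only [F, MulMemClass.coe_mul, norm_mul, PowerSeries.coeff_zero_eq_constantCoeff_apply]
    rw [hi₀, hu0, one_mul]
  -- the rest has norm < 1
  have hrest : ‖∑ ij ∈ (Finset.HasAntidiagonal.antidiagonal i₀).erase (i₀, 0), F ij‖ < 1 := by
    rcases ((Finset.HasAntidiagonal.antidiagonal i₀).erase (i₀, 0)).eq_empty_or_nonempty with h0 | hne
    · rw [h0, Finset.sum_empty, norm_zero]; exact zero_lt_one
    · obtain ⟨ij, hij, hle⟩ := IsUltrametricDist.exists_norm_finsetSum_le_of_nonempty hne F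
      refine lt_of_le_of_lt hle ?_
      rw [Finset.mem_erase, Finset.HasAntidiagonal.mem_antidiagonal] at hij
      have hj : ij.1 < i₀ := by
        rcases Nat.lt_or_ge ij.1 i₀ with h | h
        · exact h
        · exfalso
          have h1 : ij.1 = i₀ := by omega
          have h2 : ij.2 = 0 := by omega
          exact hij.1 (Prod.ext h1 h2)
      simp only [F, MulMemClass.coe_mul, norm_mul]
      calc ‖((PowerSeries.coeff ij.1 Q : 𝓞_ℂ_[p]) : ℂ_[p])‖ *
            ‖((PowerSeries.coeff ij.2 u : 𝓞_ℂ_[p]) : ℂ_[p])‖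
          ≤ ‖((PowerSeries.coeff ij.1 Q : 𝓞_ℂ_[p]) : ℂ_[p])‖ * 1 :=
            mul_le_mul_of_nonneg_left (R1.norm_coe_padicComplexInt_le_one p _) (norm_nonneg _)
        _ < 1 := by rw [mul_one]; exact hlt _ hj
  -- ultrametric: ‖a + b‖ = ‖a‖ when ‖b‖ < ‖a‖
  rw [IsUltrametricDist.norm_add_eq_max_of_norm_ne_norm (by rw [hlead]; exact hrest.ne'),
    hlead, max_eq_left hrest.le]

end Glue

/-! ### §2 The twin's ♭-frame with a unit coefficient, FROM PRINT (Hsieh 2014 Thm. B by name) -/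

section Twin

/-- **`¬ Addv E′ 3 ⟹ 9 ∤ N′`** for the level `N′ = N(E′)`: a non-additive prime is good or multiplicative,
and `p² ∣ N_E` iff the reduction at the place over `p` is additive (tree `natGenerator_sq_dvd_conductorNorm_iff`;
cf. `KimAtThree…NonAdditiveRows.not_sq_dvd_conductorNorm_of_not_addv`, in another route's cone).
[cite: Silverman1994, IV.10.2(c)] -/
theorem not_nine_dvd_level_of_not_addv (W' : WeierstrassCurve ℚ) [W'.IsElliptic] {N' : ℕ}
    (h : ¬ Addv W' 3) (hN' : W'.conductorNorm ℤ = N') : ¬ 3 ^ 2 ∣ N' := by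
  rw [← hN']
  set P : Nat.Primes := ⟨3, Nat.prime_three⟩ with hP
  set v : HeightOneSpectrum ℤ := (Rat.HeightOneSpectrum.primesEquiv (R := ℤ)).symm P with hv
  have hgen : Rat.HeightOneSpectrum.natGenerator v = 3 :=
    congrArg Subtype.val ((Rat.HeightOneSpectrum.primesEquiv (R := ℤ)).apply_symm_apply P)
  have hna : ¬ W'.HasAdditiveReductionAt v := by
    unfold Addv at h
    by_cases hg : W'.HasGoodReductionAtPrime 3
    · exact ((W'.hasGoodReductionAtPrime_iff_hasGoodReductionAt_holds P).mp hg).not_hasAdditiveReductionAt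
    · have hm : W'.HasMultiplicativeReductionAtPrime 3 := by
        by_contra hm
        exact h ⟨hg, hm⟩
      exact ((W'.hasMultiplicativeReductionAtPrime_iff_hasMultiplicativeReductionAt_holds P).mp
        hm).not_hasAdditiveReductionAt
  intro h9
  rw [← hgen] at h9
  exact hna ((natGenerator_sq_dvd_conductorNorm_iff v W').mp h9)

/-- **THE TWIN HAS A ♭-FRAME WITH `μ = 0`, FROM PRINT.** Granted Hsieh 2014 Thm. B BY NAME (`hB`), at the
twin data of crux `ToricTransportModThree` — `E′` with `E′[3] ≅ E[3]` (`O6.ModPCongruent W' W 3`),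
`ρ̄_{E,3}` onto, `E′` not additive at `3`, `N′ = N(E′)`, `K` imaginary quadratic with the classical Heegner
hypothesis for `N′`, `κ` anticyclotomic with topological generator `γ`, `𝔭 ∋ 3` of degree one, `ι′`
inducing `𝔭` — there is a ♭-frame `(Ω_K ≠ 0, ‖Ω_p‖ = 1, Q ∈ 𝓞_{ℂ_3}⟦T⟧)` with Castella's interpolation
property `R1.IsBDPLFunctionInt 3 ι′ 𝔭 κ γ f_{E′} Ω_K Ω_p Q` for THE newform `Dt'.f` of `E′` and a
coefficient of norm `1`. CONDITIONAL on the published fact `hB` only.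
[cite: Hsieh2014, Thm. B (Doc. Math. 19 p. 713) and Thm. A (p. 712)]
[cite: Castella2018, Thm. 3.1 (arXiv:1704.06608 p. 9)] -/
theorem twin_exists_isBDPLFunctionInt_coeff_norm_eq_one
    (hB : Hsieh2014.thmB_exists_isHsiehLFunction_coeff_norm_eq_one)
    (W W' : WeierstrassCurve ℚ) [W.IsElliptic] [W'.IsElliptic] (N' : ℕ) [NeZero N']
    (K : Type) [Field K] [NumberField K] (Dt' : ModularParametrizationData W' N')
    (honto : W.HasSurjectiveModNGaloisRep 3) (hcong : O6.ModPCongruent W' W 3)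
    (haddv : ¬ Addv W' 3) (hN' : W'.conductorNorm ℤ = N') (hK : IsImaginaryQuadratic K)
    (hH' : SatisfiesHeegnerHypothesis N' K) (κ : ZpExtension K 3) (hκ : κ.IsAnticyclotomic)
    (γ : Field.absoluteGaloisGroup K) [Fact (κ.IsTopGenerator γ)]
    (𝔭 : HeightOneSpectrum (𝓞 K)) (h𝔭 : ((3 : ℕ) : 𝓞 K) ∈ 𝔭.asIdeal)
    (he : 𝔭.asIdeal.ramificationIdx (𝓞 ℚ) = 1) (hf : 𝔭.asIdeal.inertiaDeg (𝓞 ℚ) = 1)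
    (ι' : PadicAlgCl 3 ≃+* ℂ) (hι' : SchneiderFree.BranchInducesPrime 3 ι' 𝔭) :
    ∃ (ΩK : ℂ) (Ωp : ℂ_[3]) (Q : PowerSeries 𝓞_ℂ_[3]), ΩK ≠ 0 ∧ ‖Ωp‖ = 1 ∧
      R1.IsBDPLFunctionInt 3 ι' 𝔭 κ γ Dt'.f ΩK Ωp Q ∧
      ∃ i : ℕ, ‖((PowerSeries.coeff i Q : 𝓞_ℂ_[3]) : ℂ_[3])‖ = 1 := by
  have h32 : (3 : ℕ) ≠ 2 := by decide
  obtain ⟨lam, rlam, hu, hinfl, htriv, hunr, hav, hfac⟩ := lambdaSupplyAt h32 ι' K κ hK hκ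
  have hsurj' : W'.HasSurjectiveModNGaloisRep 3 :=
    UniversalToricDescentReduction.hasSurjectiveModNGaloisRep_of_modPCongruent hcong honto
  have hlt : Module.finrank ℚ K < 3 := by rw [hK.1]; norm_num
  have habs : ∀ ρ : ModPGaloisRep K (ZMod 3) 2, (W'.baseChange K).IsTorsionGaloisRep 3 ρ →
      FramedRep.IsAbsolutelyIrreducible ρ := fun ρ hρ ↦
    SignedBaseChangeK1BigImage.irrM_framed_of_surj W' 3 (by exact_mod_cast hsurj') K hlt ρ hρ
  have h9 : ¬ 3 ^ 2 ∣ N' := not_nine_dvd_level_of_not_addv W' haddv hN'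
  have hsplit : ((Ideal.span {((3 : ℕ) : ℤ)}).primesOver (𝓞 K)).ncard = 2 :=
    SchneiderFree.ncard_primesOver_eq_two_of_degreeOne hK.1 h𝔭 he hf
  obtain ⟨A, ΩK, C, Ωp, Q, hA, hΩK, hC, hΩp, hQ, hμ⟩ :=
    hB ι' K 𝔭 κ γ W' Dt'.f lam rlam h32 Dt'.isNewformOf h9 hK hsplit h𝔭 hι' hH' habs hu hinfl htriv
      hunr hav hfac hκ Fact.out
  obtain ⟨ΩK₁, c, hΩK₁, hc, hframe⟩ :=
    exists_isBDPLFunctionInt_of_isHsiehLFunction_any ι' 𝔭 κ γ Dt'.f hA hΩK hC Ωp hQ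
  exact ⟨ΩK₁, Ωp, PowerSeries.C c * Q, hΩK₁, hΩp, hframe, exists_coeff_norm_eq_one_C_mul hc hμ⟩

end Twin

/-! ### §3 STUB A / child `TwinMuZeroAtThree` from Hsieh Thm. B ALONE -/

section StubA

/-- **STUB A `stub_twinMuZero` OF LINE `gvtransport` (crux 20186) = child item `TwinMuZeroAtThree`
(stmt-BirchSwinnertonDyer-20400), REGISTERED SIGNATURE VERBATIM, from Hsieh 2014 Thm. B BY NAME and
nothing else.** §2 gives the twin a ♭-frame `Q` with a unit coefficient; the cross-period, cross-receptacle
`μ`-transfer `UniversalToricDescentFlatMuTransfer.exists_coeff_norm_eq_one_of_isBDPLFunctionInt_of_isBDPLFunction`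
(power-map functional equation + reduction mod `𝔪_{ℂ_3}`; a THEOREM, any prime) moves `μ = 0` to EVERY
`R₀`-frame `L′` of `f_{E′}` with any non-zero periods. CONDITIONAL on the published fact `hB` only.
[cite: Hsieh2014, Thm. B (Doc. Math. 19 p. 713)] [cite: Castella2018, Thm. 3.1 (arXiv:1704.06608 p. 9)] -/
theorem stub_twinMuZero_of_thmB (hB : Hsieh2014.thmB_exists_isHsiehLFunction_coeff_norm_eq_one) :
  ∀ (W : WeierstrassCurve ℚ) [W.IsElliptic] [W.IsGloballyMinimal]
    (W' : WeierstrassCurve ℚ) [W'.IsElliptic] [W'.IsGloballyMinimal]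
    (N N' : ℕ) [NeZero N] [NeZero N'] (K : Type) [Field K] [NumberField K]
    (Dt : Literature.NumberTheory.EllipticCurves.ModularForms.ModularParametrizationData W N) (Dt' : Literature.NumberTheory.EllipticCurves.ModularForms.ModularParametrizationData W' N'),
    Summit.BirchSwinnertonDyer.Rank1Residual.Additive.ClassO6 W 3 → W.HasSurjectiveModNGaloisRep 3 →
    W.analyticRank = 1 → W.conductorNorm ℤ = N →
    Summit.BirchSwinnertonDyer.Rank1Residual.O6.ModPCongruent W' W 3 →
    ¬ Literature.NumberTheory.EllipticCurves.Rank1Residual.Addv W' 3 → W'.conductorNorm ℤ = N' →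
    Literature.NumberTheory.EllipticCurves.IsImaginaryQuadratic K →
    Literature.NumberTheory.EllipticCurves.SatisfiesHeegnerHypothesis N K →
    Literature.NumberTheory.EllipticCurves.SatisfiesHeegnerHypothesis N' K →
    ∀ (κ : Literature.NumberTheory.EllipticCurves.ZpExtension K 3), κ.IsAnticyclotomic →
      ∀ (γ : Field.absoluteGaloisGroup K) [Fact (κ.IsTopGenerator γ)]
        (𝔭 : IsDedekindDomain.HeightOneSpectrum (NumberField.RingOfIntegers K)),
        ((3 : ℕ) : NumberField.RingOfIntegers K) ∈ 𝔭.asIdeal →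
        𝔭.asIdeal.ramificationIdx (NumberField.RingOfIntegers ℚ) = 1 →
        𝔭.asIdeal.inertiaDeg (NumberField.RingOfIntegers ℚ) = 1 →
        ∀ (𝔭' : IsDedekindDomain.HeightOneSpectrum (NumberField.RingOfIntegers K)),
        ((3 : ℕ) : NumberField.RingOfIntegers K) ∈ 𝔭'.asIdeal → 𝔭' ≠ 𝔭 →
        ∀ (ι' : PadicAlgCl 3 ≃+* ℂ), Summit.BirchSwinnertonDyer.BirchSwinnertonDyer.Theorems.SchneiderFree.BranchInducesPrime 3 ι' 𝔭 →
          ∀ (ΩK : ℂ) (Ωp : ℂ_[3]) (L' : Literature.NumberTheory.EllipticCurves.UnrSeries 3), ΩK ≠ 0 → Ωp ≠ 0 →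
            Literature.NumberTheory.EllipticCurves.IsBDPLFunction ι' 𝔭 κ γ Dt'.f ΩK Ωp L' →
            ∃ i : ℕ, ‖((PowerSeries.coeff i L' : Literature.NumberTheory.EllipticCurves.unrIntegers 3) : ℂ_[3])‖ = 1 := by
  intro W _ _ W' _ _ N N' _ _ K _ _ Dt Dt' _hO6 honto _hr _hN hcong haddv hN' hK _hH hH' κ hκ γ _ 𝔭 h𝔭
    he hf 𝔭' _h𝔭' _hne ι' hι' ΩK Ωp L' hΩK hΩp hL'
  obtain ⟨ΩK₁, Ωp₁, Q, hΩK₁, hΩp₁, hQ, hμQ⟩ :=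
    twin_exists_isBDPLFunctionInt_coeff_norm_eq_one hB W W' N' K Dt' honto hcong haddv hN' hK hH' κ hκ
      γ 𝔭 h𝔭 he hf ι' hι'
  have hΩp₁0 : Ωp₁ ≠ 0 := fun h ↦ by rw [h, norm_zero] at hΩp₁; exact zero_ne_one hΩp₁
  exact UniversalToricDescentFlatMuTransfer.exists_coeff_norm_eq_one_of_isBDPLFunctionInt_of_isBDPLFunction
    hK hκ Fact.out hΩK₁ hΩK hΩp₁0 hΩp hQ hL' hμQ

/-- **Child item `TwinMuZeroAtThree` (stmt-BirchSwinnertonDyer-20400) BY NAME, modulo ONE published fact**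
(Hsieh 2014 Thm. B, tree `Hsieh2014.thmB_exists_isHsiehLFunction_coeff_norm_eq_one`). The route decl IS the
stub signature. CONDITIONAL on `hB`; closes 20400 the moment `hB` is granted (fact leaf by name).
[cite: Hsieh2014, Thm. B (Doc. Math. 19 p. 713)] [cite: Castella2018, Thm. 3.1 (arXiv:1704.06608 p. 9)] -/
theorem twinMuZeroAtThree_of_thmB (hB : Hsieh2014.thmB_exists_isHsiehLFunction_coeff_norm_eq_one) :
    Summit.BirchSwinnertonDyer.BirchSwinnertonDyer.Theses.UniversalToricDescent.TwinMuZeroAtThree :=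
  stub_twinMuZero_of_thmB hB

end StubA

/-! ### §4 ♭ currency (append, utd-p1 g3): EVERY ♭-frame of the twin has a unit coefficient -/

section Flat

/-- **In ♭ currency: every ♭-frame of the twin's (∅,0) `3`-adic `L`-function has `μ = 0`**, from Hsieh
2014 Thm. B by name. For the twin data of crux `ToricTransportModThree` (as in
`twin_exists_isBDPLFunctionInt_coeff_norm_eq_one`) and ANY ♭-frame `(Ω_K ≠ 0, Ω_p ≠ 0, Q′ ∈ 𝓞_{ℂ_3}⟦T⟧)`
with `R1.IsBDPLFunctionInt 3 ι′ 𝔭 κ γ f_{E′} Ω_K Ω_p Q′`: `∃ i, ‖[T^i]Q′‖ = 1`. Proof: §2's frame `Q` has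
a unit coefficient; x11b3/multr1's cross-period ♭ rigidity `X11b.R1.exists_unit_mul_eq_of_isBDPLFunctionInt`
(odd `p`) gives `Q′ = U·Q` with `U` a unit; `exists_coeff_norm_eq_one_of_isUnit_mul`. This is the reading
child 20400 would take if the steward re-types the crux's frames over `𝓞_{ℂ_3}⟦T⟧` (utd-idea LENS memo §3);
CONDITIONAL on `hB` only. [cite: Hsieh2014, Thm. B (Doc. Math. 19 p. 713)]
[cite: Castella2018, Thm. 3.1 (arXiv:1704.06608 p. 9)] -/
theorem twin_forall_isBDPLFunctionInt_coeff_norm_eq_one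
    (hB : Hsieh2014.thmB_exists_isHsiehLFunction_coeff_norm_eq_one)
    (W W' : WeierstrassCurve ℚ) [W.IsElliptic] [W'.IsElliptic] (N' : ℕ) [NeZero N']
    (K : Type) [Field K] [NumberField K] (Dt' : ModularParametrizationData W' N')
    (honto : W.HasSurjectiveModNGaloisRep 3) (hcong : O6.ModPCongruent W' W 3)
    (haddv : ¬ Addv W' 3) (hN' : W'.conductorNorm ℤ = N') (hK : IsImaginaryQuadratic K)
    (hH' : SatisfiesHeegnerHypothesis N' K) (κ : ZpExtension K 3) (hκ : κ.IsAnticyclotomic)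
    (γ : Field.absoluteGaloisGroup K) [Fact (κ.IsTopGenerator γ)]
    (𝔭 : HeightOneSpectrum (𝓞 K)) (h𝔭 : ((3 : ℕ) : 𝓞 K) ∈ 𝔭.asIdeal)
    (he : 𝔭.asIdeal.ramificationIdx (𝓞 ℚ) = 1) (hf : 𝔭.asIdeal.inertiaDeg (𝓞 ℚ) = 1)
    (ι' : PadicAlgCl 3 ≃+* ℂ) (hι' : SchneiderFree.BranchInducesPrime 3 ι' 𝔭)
    {ΩK : ℂ} {Ωp : ℂ_[3]} {Q' : PowerSeries 𝓞_ℂ_[3]} (hΩK : ΩK ≠ 0) (hΩp : Ωp ≠ 0)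
    (hQ' : R1.IsBDPLFunctionInt 3 ι' 𝔭 κ γ Dt'.f ΩK Ωp Q') :
    ∃ i : ℕ, ‖((PowerSeries.coeff i Q' : 𝓞_ℂ_[3]) : ℂ_[3])‖ = 1 := by
  obtain ⟨ΩK₁, Ωp₁, Q, hΩK₁, hΩp₁, hQ, hμQ⟩ :=
    twin_exists_isBDPLFunctionInt_coeff_norm_eq_one hB W W' N' K Dt' honto hcong haddv hN' hK hH' κ hκ
      γ 𝔭 h𝔭 he hf ι' hι'
  have hΩp₁0 : Ωp₁ ≠ 0 := fun h ↦ by rw [h, norm_zero] at hΩp₁; exact zero_ne_one hΩp₁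
  obtain ⟨U, hU, hUQ⟩ := R1.exists_unit_mul_eq_of_isBDPLFunctionInt (p := 3) (by decide) hK hκ Fact.out
    hΩK₁ hΩK hΩp₁0 hΩp hQ hQ'
  rw [hUQ]
  exact exists_coeff_norm_eq_one_of_isUnit_mul hU hμQ

end Flat

end Summit.BirchSwinnertonDyer.BirchSwinnertonDyer.Theorems.UniversalToricDescentTwinMuZero

end
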